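import Literature.NumberTheory.EllipticCurves.NewformGaloisRepModLProofs
import Literature.NumberTheory.EllipticCurves.NewformsEigenpacketProofs
import Literature.NumberTheory.EllipticCurves.DeligneSerreProp27LevelDescentProofs
import Literature.NumberTheory.LFunctions.ChebotarevDensityProofs
import Literature.RepresentationTheory.Semisimple.FiniteFieldDescentAbsIrred
import HarnessLib

/-!
# Deligne–Serre 1974, Thm. 6.7 in weight one from Deligne's theorem **for newforms**

The named fact `thm67_weightOne` (`NewformGaloisRepModL`: the mod-`ℓ` representations attached to
a weight-one newform `f ∈ S_1(Γ₁(N))` and `ι : 𝓞_f → 𝔽_ℓ`) is proved in the tree from Deligne's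
Thm. 6.1 **as printed by Deligne–Serre** (op. cit. p. 520: `λ`-adic representations attached to an
arbitrary `T_p`-eigenform (`p ∤ M`) of weight `k ≥ 2`, at every finite place `λ`;
`thm67_weightOne_of_thm61`, `DeligneSerreWeightOneOfThm67.thm67_weightOne_of_deligneThm61`).  Every
other printed form of Deligne's theorem — Deligne 1971 (Sém. Bourbaki 355), Ribet 1977 Thm. (2.1),
Diamond–Shurman Thm. 9.6.5, Darmon–Diamond–Taylor Thm. 3.1 — is a statement about **newforms**.
This proofs-only file (theorems only: no definition, no named fact; D-0026) closes the gap between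
the two shapes inside the proof of Thm. 6.7, so that the named fact is discharged by Deligne's
theorem in its newform shape as well:

* `exists_newform_congr_of_weight_one` — **6.8–6.11 with Atkin–Lehner–Li**: for a weight-one
  newform `f`, a prime `ℓ` and `ι : 𝓞_f → 𝔽_ℓ` there are a number field `K ⊆ ℂ`, an embedding
  `i : K_f → K` over `ℂ`, a finite place `v` of `K` over `λ = ker ι`, a weight `k' ≥ 2` with
  `(ℓ - 1) ∣ (k' - 1)` and a **newform** `g₀` of weight `k'` and some level `M₀ ∣ N ℓ`, with
  coefficient field `K_{g₀} ⊆ K`, whose Hecke eigenvalues are `v`-integral and satisfy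
  `a_p(g₀) ≡ a_p(f)`, `ε_{g₀}(p) = ε_f(p)` (mod `v`, resp. exactly) for the primes `p ∤ N ℓ`.
  Proof: the eigenform `g ∈ S_{k'}(Γ₁(N ℓ), ε)` of `exists_eigenform_congr_of_weight_one`
  (op. cit. 6.8–6.11, proved in `DeligneSerreLiftModL`) has the eigenvalue packet of a newform
  `g₀` of level dividing `N ℓ` (`exists_isNewform1_of_eigenpacket`, Diamond–Shurman Thm. 5.8.2–5.8.3;
  Deligne–Serre use this tacitly, Thm. 6.1 being stated for eigenforms); `K` is the compositum of
  the field of 6.11 and `K_{g₀}` (a number field by (2.7.2)–(2.7.3) at level `M₀`,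
  `DeligneSerre1974_span_integralLattice1_holds`), `v` any place of it over the place of 6.11
  (going up, Mathlib `Ideal.exists_ideal_over_maximal_of_isIntegral`).
* `thm67_weightOne_of_thm61_newform` — Thm. 6.7 in weight one (the named fact `thm67_weightOne`)
  from **Thm. 6.1 for newforms** at every finite place: for a newform `g` of weight `k ≥ 2` and
  level `M`, a number field `K ⊆ ℂ` containing the `a_n(g)` and the `ε_g(d)`, and every finite
  place `v` of `K`, a continuous `ρ : Gal(ℚ̄/ℚ) → GL₂(K_v)` unramified at the primes `p ∤ M`,
  `p ∉ v`, with `det(X - ρ(F_p)) = X² - a_p(g) X + ε_g(p) p^{k-1}` (Deligne–Serre Thm. 6.1 for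
  `f = g`; Diamond–Shurman Thm. 9.6.5 with any `K ⊇ K_g`; Ribet 1977, Thm. (2.1)).  Proof: the
  previous theorem, the hypothesis at `(g₀, K, v)`, and the core of the printed proof 6.12–6.13
  (`thm67_weightOne_core`), with Chebotarev ((6.12.1), `dirichletDensity_eq_holds`), Lemme 6.13
  (`exists_descent_fin_two`) and (2.7.2) in weight one (`DeligneSerre1974_span_integralLattice1_holds`)
  discharged by the tree.
* `thm67_weightOne_of_thm61_isNewform1` — the same from Thm. 6.1 in the binders of
  `thm67_weightOne_of_thm61` (abstract number field `K` with an embedding `e : K → ℂ`, eigenvalues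
  `T_p g = e(a_p) g`) **restricted to newforms** `g`;
  `thm67_weightOne_of_thm61_intermediateField` — the same for eigenforms over subfields `K ⊆ ℂ`.
  (None of these hypotheses asks for the semisimplicity of `ρ`, which the proof does not use.)

## References

* P. Deligne, J.-P. Serre, *Formes modulaires de poids 1*, Ann. Sci. ÉNS (4) 7 (1974), 507–530:
  Thm. 6.1 (p. 520), 6.6–6.7 and 6.8–6.13 (pp. 521–523), §8.2 (p. 525). [DeligneSerreASENS1974]
* F. Diamond, J. Shurman, *A first course in modular forms*, GTM 228, Springer 2005: Thm. 5.8.2,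
  Thm. 5.8.3, Thm. 9.6.5. [DiamondShurman2005]
* K. A. Ribet, *Galois representations attached to eigenforms with Nebentypus*, LNM 601 (1977),
  17–51, Thm. (2.1). [Ribet1977Nebentypus]
-/

noncomputable section

open scoped MatrixGroups ModularForm NumberField Polynomial

open CongruenceSubgroup IsDedekindDomain Polynomial Rat.HeightOneSpectrum Field

namespace Literature.NumberTheory.EllipticCurves.ModularForms.DeligneSerre1974

variable {N : ℕ} [NeZero N]

/-! ### 6.8–6.11 with a newform -/

set_option maxHeartbeats 800000 in
/-- **Deligne–Serre 1974, 6.8–6.11, with the eigenform replaced by a newform (Atkin–Lehner–Li).**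
Let `f ∈ S_1(Γ₁(N))` be a newform with nebentypus `ε` and coefficients `a_p`, `ℓ` a prime and
`ι : 𝓞_f → 𝔽_ℓ` (`λ = ker ι`).  There are a number field `K ⊆ ℂ`, `i : K_f → K` over `ℂ`, a finite
place `v` of `K` over `λ` (`v(i y) < 1` when `ι y = 0`), `k' ≥ 2` with `(ℓ - 1) ∣ (k' - 1)`, a
newform `g₀ ∈ S_{k'}(Γ₁(M₀))`, `M₀ ∣ N ℓ`, with `K_{g₀} ⊆ K`, and its eigenvalues `a_n = a_n(g₀)`,
`c(d) = ε_{g₀}(d)` as elements of `K`, such that every `a_n` is `v`-integral,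
`a_p ≡ a_p(f) (mod v)` and `c(p) = ε(p)` for every prime `p ∤ N ℓ`.  (6.8–6.11 give an eigenform
`g` of level `N ℓ` and type `(k', ε)` with `T_p g = b_p g`, `b_p ≡ a_p(f)`; its packet is that of
a newform `g₀` of level `M₀ ∣ N ℓ`, `exists_isNewform1_of_eigenpacket`; `K` is the compositum of
the field of 6.11 with `K_{g₀}`, `v` a place above that of 6.11.)
[cite: DeligneSerreASENS1974, 6.8–6.11 with Thm. 6.1] -/
theorem exists_newform_congr_of_weight_one {f : CuspForm (Gamma1 N) 1} (hf : IsNewform1 f)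
    (ℓ : ℕ) [Fact ℓ.Prime] (ι : coeffCharIntegers f →+* ZMod ℓ) :
    ∃ (K : IntermediateField ℚ ℂ) (_ : NumberField K) (i : coeffCharField f →+* K)
      (v : HeightOneSpectrum (𝓞 K)) (k' : ℤ) (M₀ : ℕ) (_ : NeZero M₀) (_ : M₀ ∣ N * ℓ)
      (g₀ : CuspForm (Gamma1 M₀) k') (a : ℕ → K) (c : ZMod M₀ → K),
      coeffCharField g₀ ≤ K ∧ (∀ y, ((i y : K) : ℂ) = y) ∧ 2 ≤ k' ∧ ((ℓ : ℤ) - 1 ∣ k' - 1) ∧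
      IsNewform1 g₀ ∧ (∀ n, ((a n : K) : ℂ) = cuspCoeff g₀ n) ∧
      (∀ d, ((c d : K) : ℂ) = nebentypus g₀ d) ∧
      (∀ y : coeffCharIntegers f, ι y = 0 → v.valuation K (i y) < 1) ∧
      (∀ n : ℕ, v.valuation K (a n) ≤ 1) ∧
      (∀ p : ℕ, p.Prime → ¬ p ∣ N * ℓ →
        v.valuation K (a p - i ⟨cuspCoeff f p, cuspCoeff_mem_coeffCharField f p⟩) < 1) ∧
      (∀ p : ℕ, p.Prime → ¬ p ∣ N * ℓ →
        c p = i ⟨(nebentypus f (p : ZMod N) : ℂ), nebentypus_mem_coeffCharField f p⟩) := by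
  classical
  have hℓ : ℓ.Prime := Fact.out
  haveI : NeZero (N * ℓ) := ⟨mul_ne_zero (NeZero.ne N) hℓ.ne_zero⟩
  -- ### 6.8–6.11: the eigenform `g` of weight `k' ≥ 2` at level `N ℓ`
  obtain ⟨K, _, _, e, i, v, k', g, b, hei, hk', hℓk', hg0, hgW, hgT, hker, hbint, hbcongr⟩ :=
    exists_eigenform_congr_of_weight_one (DeligneSerre1974_span_integralLattice1_holds N 1) hf ℓ ι
  set ε : DirichletCharacter ℂ N := nebentypus f with hεdef
  -- ### Atkin–Lehner–Li: the newform `g₀` with the packet of `g`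
  obtain ⟨M₀, _, hM₀, g₀, hg₀, hag₀, hχ₀⟩ :=
    exists_isNewform1_of_eigenpacket hg0 hgW (a := fun p ↦ e (b p)) hgT
  -- ### `K_{g₀}` is a number field and the `a_n(g₀)` are integers ((2.7.2) at level `M₀`)
  have hL₀ := DeligneSerre1974_span_integralLattice1_holds M₀ k'
  haveI : FiniteDimensional ℚ (coeffField g₀) :=
    (IsNewform1.finiteDimensional_coeffField_of_span_integralLattice1 hL₀) hg₀
  haveI : FiniteDimensional ℚ (coeffCharField g₀) := finiteDimensional_coeffCharField g₀
  have hint₀ : ∀ n, IsIntegral ℤ (cuspCoeff g₀ n) := fun n ↦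
    IsNewform1.isIntegral_cuspCoeff hL₀ (by omega) hg₀ n
  -- ### the compositum `K' = e(K) K_{g₀} ⊆ ℂ`
  let eA : K →ₐ[ℚ] ℂ := e.toRatAlgHom
  have heA : ∀ x, eA x = e x := fun _ ↦ rfl
  let K₁ : IntermediateField ℚ ℂ := eA.fieldRange
  haveI : FiniteDimensional ℚ K₁ :=
    LinearEquiv.finiteDimensional eA.equivFieldRange.toLinearEquiv
  let K' : IntermediateField ℚ ℂ := K₁ ⊔ coeffCharField g₀
  haveI : FiniteDimensional ℚ K' := IntermediateField.finiteDimensional_sup K₁ (coeffCharField g₀)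
  haveI hK' : NumberField K' := NumberField.mk
  have hle₁ : K₁ ≤ K' := le_sup_left
  have hle₀ : coeffCharField g₀ ≤ K' := le_sup_right
  -- `j : K → K'` and `i' = j ∘ i : K_f → K'`
  have hjmem : ∀ x : K, e x ∈ K' := fun x ↦ hle₁ (AlgHom.mem_fieldRange.mpr ⟨x, rfl⟩)
  let j : K →+* K' := e.codRestrict K' hjmem
  have hj : ∀ x, ((j x : K') : ℂ) = e x := fun _ ↦ rfl
  have hjinj : Function.Injective j := j.injective
  let i' : coeffCharField f →+* K' := j.comp i
  have hi' : ∀ y, ((i' y : K') : ℂ) = y := fun y ↦ by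
    change ((j (i y) : K') : ℂ) = y
    rw [hj, hei]
  -- integrality in `K'` is detected in `ℂ`
  have hintK' : ∀ {x : K'}, IsIntegral ℤ (x : ℂ) → IsIntegral ℤ x := fun {x} hx ↦
    (isIntegral_algHom_iff (algebraMap K' ℂ).toIntAlgHom (algebraMap K' ℂ).injective).mp hx
  have hintK : ∀ {x : K}, IsIntegral ℤ (j x) → IsIntegral ℤ x := fun {x} hx ↦
    (isIntegral_algHom_iff j.toIntAlgHom hjinj).mp hx
  -- ### a place `v'` of `K'` above `v` (going up)
  letI : Algebra K K' := j.toAlgebra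
  have halg : ∀ r : 𝓞 K, ((algebraMap (𝓞 K) (𝓞 K') r : 𝓞 K') : K') = j (r : K) := fun _ ↦ rfl
  have hkerle : RingHom.ker (algebraMap (𝓞 K) (𝓞 K')) ≤ v.asIdeal := by
    intro r hr
    rw [RingHom.mem_ker] at hr
    have h0 : j (r : K) = 0 := by rw [← halg, hr]; rfl
    have : r = 0 :=
      NumberField.RingOfIntegers.coe_eq_zero_iff.mp (hjinj (show j (r : K) = j 0 by
        rw [h0, map_zero]))
    rw [this]; exact zero_mem _
  obtain ⟨Q, hQmax, hQ⟩ :=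
    Ideal.exists_ideal_over_maximal_of_isIntegral (S := 𝓞 K') v.asIdeal hkerle
  have hℓv : ((ℓ : ℕ) : 𝓞 K) ∈ v.asIdeal := by
    have h1 := hker (ℓ : coeffCharIntegers f) (by rw [map_natCast, ZMod.natCast_self])
    rw [show (((ℓ : coeffCharIntegers f) : coeffCharField f)) = (ℓ : coeffCharField f) by simp,
      map_natCast] at h1
    rw [← v.valuation_lt_one_iff_mem (K := K)]
    simpa using h1
  have hQne : Q ≠ ⊥ := by
    intro hQ0
    have hmem : ((ℓ : ℕ) : 𝓞 K') ∈ Q := by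
      have : algebraMap (𝓞 K) (𝓞 K') (ℓ : 𝓞 K) ∈ Q := by
        rw [← Ideal.mem_comap, hQ]; exact hℓv
      simpa using this
    rw [hQ0, Ideal.mem_bot] at hmem
    exact hℓ.ne_zero (by exact_mod_cast hmem)
  let v' : HeightOneSpectrum (𝓞 K') := ⟨Q, hQmax.isPrime, hQne⟩
  -- transport of congruences along `j` for integral elements
  have htrans : ∀ r : 𝓞 K, r ∈ v.asIdeal → v'.valuation K' (j (r : K)) < 1 := by
    intro r hr
    rw [← halg, v'.valuation_lt_one_iff_mem (K := K')]
    change algebraMap (𝓞 K) (𝓞 K') r ∈ Q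
    rw [← Ideal.mem_comap, hQ]; exact hr
  -- ### the data in `K'`
  let a : ℕ → K' := fun n ↦ ⟨cuspCoeff g₀ n, hle₀ (cuspCoeff_mem_coeffCharField g₀ n)⟩
  have hcmem : ∀ d : ZMod M₀, (nebentypus g₀ d : ℂ) ∈ K' := fun d ↦ by
    rw [← ZMod.natCast_zmod_val d]
    exact hle₀ (nebentypus_mem_coeffCharField g₀ d.val)
  let c : ZMod M₀ → K' := fun d ↦ ⟨nebentypus g₀ d, hcmem d⟩
  -- `a_p(g₀) = j(b_p)` for `p ∤ N ℓ`
  have hab : ∀ p : ℕ, p.Prime → ¬ p ∣ N * ℓ → a p = j (b p) := fun p hp hpNℓ ↦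
    Subtype.ext (by rw [hj]; exact hag₀ p hp hpNℓ)
  refine ⟨K', hK', i', v', k', M₀, inferInstance, hM₀, g₀, a, c, hle₀, hi', hk', hℓk', hg₀,
    fun _ ↦ rfl, fun _ ↦ rfl, ?_, ?_, ?_, ?_⟩
  · -- `v'` lies over `λ`
    intro y hy
    let r : 𝓞 K := coeffCharIntegersMap f i y
    have hr : (r : K) = i y := rfl
    have hrv : r ∈ v.asIdeal := by
      rw [← v.valuation_lt_one_iff_mem (K := K)]; exact hker y hy
    have := htrans r hrv
    rwa [hr] at this
  · -- the `a_n(g₀)` are integers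
    intro n
    have hint : IsIntegral ℤ (a n) := hintK' (hint₀ n)
    exact v'.valuation_le_one (K := K') ⟨a n, hint⟩
  · -- `a_p(g₀) ≡ a_p(f) (mod v')` for `p ∤ N ℓ`
    intro p hp hpNℓ
    have hx₁ : IsIntegral ℤ (b p) := hintK (by rw [← hab p hp hpNℓ]; exact hintK' (hint₀ p))
    have hx₂ : IsIntegral ℤ (i ⟨cuspCoeff f p, cuspCoeff_mem_coeffCharField f p⟩) :=
      (coeffCharIntegersMap f i ⟨⟨cuspCoeff f p, cuspCoeff_mem_coeffCharField f p⟩,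
        (isIntegral_coeffCharField_iff f).mpr (IsNewform1.isIntegral_cuspCoeff
          (DeligneSerre1974_span_integralLattice1_holds N 1) le_rfl hf p)⟩).2
    let r : 𝓞 K := ⟨b p - i ⟨cuspCoeff f p, cuspCoeff_mem_coeffCharField f p⟩, hx₁.sub hx₂⟩
    have hrv : r ∈ v.asIdeal := by
      rw [← v.valuation_lt_one_iff_mem (K := K)]; exact hbcongr p hp hpNℓ
    have h := htrans r hrv
    have hrj : j (r : K) = a p - i' ⟨cuspCoeff f p, cuspCoeff_mem_coeffCharField f p⟩ := by
      change j (b p - i _) = a p - j (i _)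
      rw [map_sub, hab p hp hpNℓ]
    rwa [hrj] at h
  · -- `ε_{g₀}(p) = ε(p)` for `p ∤ N ℓ`
    intro p hp hpNℓ
    have hcop : IsCoprime (p : ℤ) ((N * ℓ : ℕ) : ℤ) :=
      Nat.isCoprime_iff_coprime.mpr ((Nat.Prime.coprime_iff_not_dvd hp).mpr hpNℓ)
    have h₁ : DirichletCharacter.changeLevel hM₀ (nebentypus g₀) (p : ZMod (N * ℓ)) =
        nebentypus g₀ (p : ZMod M₀) := by
      have := DirichletCharacter.changeLevel_eq_cast_of_dvd' (nebentypus g₀) hM₀ hcop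
      simpa using this
    have h₂ : DirichletCharacter.changeLevel (dvd_mul_right N ℓ) ε (p : ZMod (N * ℓ)) =
        ε (p : ZMod N) := by
      have := DirichletCharacter.changeLevel_eq_cast_of_dvd' ε (dvd_mul_right N ℓ) hcop
      simpa using this
    apply Subtype.ext
    change (nebentypus g₀ (p : ZMod M₀) : ℂ) = ((i' _ : K') : ℂ)
    rw [hi', ← h₁, hχ₀, h₂]

/-! ### Thm. 6.7 in weight one from Thm. 6.1 for newforms -/

/-- **Deligne–Serre 1974, Thm. 6.7 in weight one (`thm67_weightOne`) from Deligne's theorem for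
newforms at every finite place.**  Hypothesis `h61` — Thm. 6.1 of op. cit. (p. 520) for a
*newform* `g ∈ S_k(Γ₁(M))`, `k ≥ 2` (Deligne 1971; Ribet 1977, Thm. (2.1); Diamond–Shurman
Thm. 9.6.5, arithmetic Frobenius): for every number field `K ⊆ ℂ` containing the `a_n(g)` and the
`ε_g(d)` (given as `a : ℕ → K`, `c : ℤ/Mℤ → K`) and every finite place `v` of `K` there is a
continuous `ρ : Gal(ℚ̄/ℚ) → GL₂(K_v)` unramified at the primes `p ∤ M` with `p ∉ v`, where
`det(X - ρ(F_p)) = X² - a_p X + ε_g(p) p^{k-1}` (6.1.1).  Conclusion: the named fact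
`thm67_weightOne`.  Proof: `exists_newform_congr_of_weight_one` (6.8–6.11 and Atkin–Lehner–Li),
`h61` at `(g₀, K, v)`, and 6.12–6.13 (`thm67_weightOne_core`) with Chebotarev, Lemme 6.13 and
(2.7.2) discharged (`dirichletDensity_eq_holds`, `exists_descent_fin_two`,
`DeligneSerre1974_span_integralLattice1_holds`). [cite: DeligneSerreASENS1974, Thm. 6.7 with Thm. 6.1 and 6.8–6.13] -/
theorem thm67_weightOne_of_thm61_newform
    (h61 : ∀ (M : ℕ) [NeZero M] (k : ℤ), 2 ≤ k → ∀ (g : CuspForm (Gamma1 M) k), IsNewform1 g →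
      ∀ (K : IntermediateField ℚ ℂ) [NumberField K] (a : ℕ → K) (c : ZMod M → K),
        (∀ n, ((a n : K) : ℂ) = cuspCoeff g n) → (∀ d, ((c d : K) : ℂ) = nebentypus g d) →
      ∀ v : HeightOneSpectrum (𝓞 K),
        ∃ ρ : GaloisRepresentations.FramedGaloisRep ℚ (v.adicCompletion K) 2,
          ∀ w : HeightOneSpectrum (𝓞 ℚ), ¬ ((primesEquiv w : Nat.Primes) : ℕ) ∣ M →
            (((primesEquiv w : Nat.Primes) : ℕ) : 𝓞 K) ∉ v.asIdeal →
            ρ.IsUnramifiedAt w ∧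
            ρ.HasFrobCharpolyAt w
              ((X ^ 2 - C (a ((primesEquiv w : Nat.Primes) : ℕ)) * X +
                C (c ((primesEquiv w : Nat.Primes) : ℕ) *
                  (((primesEquiv w : Nat.Primes) : ℕ) : K) ^ (k - 1))).map
                (algebraMap K (v.adicCompletion K)))) :
    thm67_weightOne (N := N) := by
  intro f hf ℓ _ ι
  obtain ⟨K, _, i, v, k', M₀, _, hM₀, g₀, a, c, -, -, hk', hℓk', hg₀, ha, hc, hker, haint,
    hacongr, hcp⟩ := exists_newform_congr_of_weight_one hf ℓ ι
  obtain ⟨ρ, hρ⟩ := h61 M₀ k' hk' g₀ hg₀ K a c ha hc v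
  exact thm67_weightOne_core
    (fun _ _ _ _ _ _ _ _ j φ _ hQ ↦
      Literature.RepresentationTheory.Semisimple.exists_descent_fin_two j φ hQ)
    LFunctions.Chebotarev.dirichletDensity_eq_holds
    (DeligneSerre1974_span_integralLattice1_holds N 1) hf ℓ ι i v hk' hℓk' a
    (fun p ↦ c (p : ZMod M₀)) hker haint hacongr hcp ρ
    (fun w hw hwv ↦ hρ w (fun h ↦ hw (h.trans hM₀)) hwv)

/-- **Deligne–Serre 1974, Thm. 6.7 in weight one (`thm67_weightOne`) from Thm. 6.1 restricted to
newforms**, in the binders of `thm67_weightOne_of_thm61` (an abstract number field `K` with an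
embedding `e : K → ℂ`, `a_p, χ(d) ∈ K` through `e`, `T_p g = e(a_p) g` for `p ∤ M`, `g ∈ S_k(M, χ)`,
`g ≠ 0`) with the extra hypothesis that `g` is a newform — the form in which Thm. 6.1 is proved in
print (Deligne 1971 for newforms; Deligne–Serre state it for eigenforms).  Reduced to
`thm67_weightOne_of_thm61_newform`: for a newform, `T_p g = a_p(g) g`
(`IsNewform1.heckeEigenvalue_eq_coeff_holds`), `g ∈ S_k(M, ε_g)`
(`IsNewform1.mem_nebentypusSubspace_nebentypus_holds`) and `g ≠ 0`.
[cite: DeligneSerreASENS1974, Thm. 6.7 with Thm. 6.1 and 6.8–6.13] -/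
theorem thm67_weightOne_of_thm61_isNewform1
    (h61 : ∀ (M : ℕ) [NeZero M] (k : ℤ), 2 ≤ k →
      ∀ (g : CuspForm (Gamma1 M) k) (χ : DirichletCharacter ℂ M), IsNewform1 g →
        g ∈ nebentypusSubspace M k χ → g ≠ 0 →
      ∀ (K : Type) [Field K] [NumberField K] (e : K →+* ℂ) (a : ℕ → K) (c : ZMod M → K),
        (∀ d, e (c d) = χ d) →
        (∀ (p : ℕ) (hp : p.Prime), ¬ p ∣ M →
          (haveI : NeZero p := ⟨hp.ne_zero⟩; heckeT (Gamma1 M) k p g) = e (a p) • g) →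
      ∀ v : HeightOneSpectrum (𝓞 K),
        ∃ ρ : GaloisRepresentations.FramedGaloisRep ℚ (v.adicCompletion K) 2,
          ∀ w : HeightOneSpectrum (𝓞 ℚ), ¬ ((primesEquiv w : Nat.Primes) : ℕ) ∣ M →
            (((primesEquiv w : Nat.Primes) : ℕ) : 𝓞 K) ∉ v.asIdeal →
            ρ.IsUnramifiedAt w ∧
            ρ.HasFrobCharpolyAt w
              ((X ^ 2 - C (a ((primesEquiv w : Nat.Primes) : ℕ)) * X +
                C (c ((primesEquiv w : Nat.Primes) : ℕ) *
                  (((primesEquiv w : Nat.Primes) : ℕ) : K) ^ (k - 1))).map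
                (algebraMap K (v.adicCompletion K)))) :
    thm67_weightOne (N := N) := by
  refine thm67_weightOne_of_thm61_newform fun M _ k hk g hg K _ a c ha hc v ↦ ?_
  refine h61 M k hk g (nebentypus g) hg (IsNewform1.mem_nebentypusSubspace_nebentypus_holds hg)
    hg.ne_zero K (algebraMap K ℂ) a c hc (fun p hp _ ↦ ?_) v
  haveI : NeZero p := ⟨hp.ne_zero⟩
  have h := heckeT_eq_heckeEigenvalue_smul g p (hg.2.1 p hp)
  rw [IsNewform1.heckeEigenvalue_eq_coeff_holds hg hp] at h
  rw [h]
  exact congrArg (· • g) (ha p).symm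

/-- **Deligne–Serre 1974, Thm. 6.7 in weight one (`thm67_weightOne`) from Thm. 6.1 for eigenforms
over number fields `K ⊆ ℂ`** — the binders of `thm67_weightOne_of_thm61` with the abstract number
field and its embedding replaced by a subfield `K ⊆ ℂ` (`IntermediateField ℚ ℂ`), as in 6.6 of
op. cit. ("Soient `K ⊂ C` un corps de nombres algébriques, `λ` une place finie de `K` …").
Reduced to `thm67_weightOne_of_thm61_newform` through a newform `g` with `χ = ε_g`, `T_p g = a_p(g) g`.
[cite: DeligneSerreASENS1974, Thm. 6.7 with Thm. 6.1 and 6.6] -/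
theorem thm67_weightOne_of_thm61_intermediateField
    (h61 : ∀ (M : ℕ) [NeZero M] (k : ℤ), 2 ≤ k →
      ∀ (g : CuspForm (Gamma1 M) k) (χ : DirichletCharacter ℂ M),
        g ∈ nebentypusSubspace M k χ → g ≠ 0 →
      ∀ (K : IntermediateField ℚ ℂ) [NumberField K] (a : ℕ → K) (c : ZMod M → K),
        (∀ d, ((c d : K) : ℂ) = χ d) →
        (∀ (p : ℕ) (hp : p.Prime), ¬ p ∣ M →
          (haveI : NeZero p := ⟨hp.ne_zero⟩; heckeT (Gamma1 M) k p g) = ((a p : K) : ℂ) • g) →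
      ∀ v : HeightOneSpectrum (𝓞 K),
        ∃ ρ : GaloisRepresentations.FramedGaloisRep ℚ (v.adicCompletion K) 2,
          ∀ w : HeightOneSpectrum (𝓞 ℚ), ¬ ((primesEquiv w : Nat.Primes) : ℕ) ∣ M →
            (((primesEquiv w : Nat.Primes) : ℕ) : 𝓞 K) ∉ v.asIdeal →
            ρ.IsUnramifiedAt w ∧
            ρ.HasFrobCharpolyAt w
              ((X ^ 2 - C (a ((primesEquiv w : Nat.Primes) : ℕ)) * X +
                C (c ((primesEquiv w : Nat.Primes) : ℕ) *
                  (((primesEquiv w : Nat.Primes) : ℕ) : K) ^ (k - 1))).map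
                (algebraMap K (v.adicCompletion K)))) :
    thm67_weightOne (N := N) := by
  refine thm67_weightOne_of_thm61_newform fun M _ k hk g hg K _ a c ha hc v ↦ ?_
  refine h61 M k hk g (nebentypus g) (IsNewform1.mem_nebentypusSubspace_nebentypus_holds hg)
    hg.ne_zero K a c hc (fun p hp _ ↦ ?_) v
  haveI : NeZero p := ⟨hp.ne_zero⟩
  have h := heckeT_eq_heckeEigenvalue_smul g p (hg.2.1 p hp)
  rw [IsNewform1.heckeEigenvalue_eq_coeff_holds hg hp] at h
  rw [h]
  exact congrArg (· • g) (ha p).symm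

end Literature.NumberTheory.EllipticCurves.ModularForms.DeligneSerre1974

end
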